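import Summits.FinalStateConjecture.FinalStateConjecture.Theorems.BartnikGapSettlingGapExhaustionMetricInCoordsCompAffine
import HarnessLib

/-!
# Operator-norm bounds for iterated derivatives under an affine reparametrisation
(crux `GapExhaustion`, stmt-FinalStateConjecture-10808, line photon-shell-pseudoconvexity;
stub (N-3c) `stub_affineIteratedFDerivBounds`, glue for the chart form of the Ionescu–Klainerman
local Killing-extension theorem, whose smoothness hypothesis is one constant
`A ≥ Σ_{j=1}^{6} ‖Dʲ G̃‖ + Σ_{j=1}^{4} ‖Dʲ f̃‖` on the unit ball for the REPARAMETRISED data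
`G̃ y = G (c + L' y) ∘ (L × L)` and `f̃ y = s⁻² (r (c + L' y) − c₀)`)

Generic calculus (Mathlib's calculus of iterated Fréchet derivatives under linear / affine
changes of variable, no geometry). For a continuous linear `L' : E4 →L[ℝ] E4`, `c ∈ E4`, an open
`O ⊆ E4` and a point `y` with `c + L' y ∈ O`:

1. if `f : E4 → F` is `C^∞` on `O` (any normed target `F`), then
   `‖Dʲ(y ↦ f (c + L' y))(y)‖ ≤ ‖L'‖ʲ · ‖Dʲ f (c + L' y)‖`: on the open neighbourhood
   `L'⁻¹((c + ·)⁻¹ O)` of `y` the map is `(z ↦ f (c + z)) ∘ L'`, whose `j`-th derivative within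
   that set is `Dʲ(z ↦ f (c + z))(L' y) ∘ (L', …, L') = Dʲ f (c + L' y) ∘ (L', …, L')`
   (`ContinuousLinearMap.iteratedFDerivWithin_comp_right`, `iteratedFDeriv_comp_add_left`), of
   norm `≤ ‖Dʲ f (c + L' y)‖ · ∏ ‖L'‖` (`ContinuousMultilinearMap.norm_compContinuousLinearMap_le`);
   no invertibility of `L'` is needed (`L' = 0` is allowed);
2. if `G : E4 → (E4 →L[ℝ] E4 →L[ℝ] ℝ)` is `C^∞` on `O` and `L : E4 →L[ℝ] E4`, then
   `‖Dʲ(y ↦ G (c + L' y) (L ·, L ·))(y)‖ ≤ ‖L‖² · ‖L'‖ʲ · ‖Dʲ G (c + L' y)‖`: the map is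
   `B ∘ (y ↦ G (c + L' y))` with `B : G ↦ G (L ·, L ·)` continuous LINEAR of norm `≤ ‖L‖²`
   (`compAffine_exists_bilinearCompCLM` of the W4-A template), so its `j`-th derivative is
   `B ∘ Dʲ(y ↦ G (c + L' y))(y)` (`ContinuousLinearMap.iteratedFDeriv_comp_left`), and 1 applies.
-/

noncomputable section

-- instance search through the nested operator types `E4 →L[ℝ] E4 →L[ℝ] ℝ`
set_option maxSynthPendingDepth 3

-- D-0017: single-problem summit, `Summit.<S>.<S>.…` by design (lakefile `weak.linter.dupNamespace`)
set_option linter.dupNamespace false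

namespace Summit.FinalStateConjecture.FinalStateConjecture.Theorems

open Set Function
open Literature.Geometry.Lorentzian
open scoped ContDiff Topology

/-- **`Cʲ` size after an affine reparametrisation of the argument.** If `f` is `C^∞` on the open
set `O` and `c + L' y ∈ O`, then
`‖Dʲ(y ↦ f (c + L' y))(y)‖ ≤ ‖L'‖ʲ · ‖Dʲ f (c + L' y)‖`: near `y` the map is
`(z ↦ f (c + z)) ∘ L'`, with `j`-th derivative `Dʲ f (c + L' y) ∘ (L', …, L')`
(Mathlib `ContinuousLinearMap.iteratedFDerivWithin_comp_right`, `iteratedFDeriv_comp_add_left`),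
of norm at most `‖Dʲ f (c + L' y)‖ · ‖L'‖ʲ`
(`ContinuousMultilinearMap.norm_compContinuousLinearMap_le`). No invertibility of `L'` is used.
[folklore] -/
theorem affineBounds_norm_iteratedFDeriv_comp_affine_le {F : Type*} [NormedAddCommGroup F]
    [NormedSpace ℝ F] (f : E4 → F) (L' : E4 →L[ℝ] E4) (c : E4) {O : Set E4} (hO : IsOpen O)
    (hf : ContDiffOn ℝ ∞ f O) (j : ℕ) {y : E4} (hy : c + L' y ∈ O) :
    ‖iteratedFDeriv ℝ j (fun y : E4 => f (c + L' y)) y‖ ≤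
      ‖L'‖ ^ j * ‖iteratedFDeriv ℝ j f (c + L' y)‖ := by
  -- the translate `z ↦ f (c + z)`, `C^∞` on the open set `O' = (c + ·)⁻¹ O`
  have hO' : IsOpen ((fun z : E4 => c + z) ⁻¹' O) :=
    hO.preimage (continuous_const.add continuous_id)
  have hf' : ContDiffOn ℝ ∞ (fun z : E4 => f (c + z)) ((fun z : E4 => c + z) ⁻¹' O) :=
    hf.comp (contDiff_const.add contDiff_id).contDiffOn (mapsTo_preimage _ _)
  -- the open neighbourhood `S = L'⁻¹ O'` of `y`
  have hS : IsOpen (L' ⁻¹' ((fun z : E4 => c + z) ⁻¹' O)) := hO'.preimage L'.continuous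
  have hyO' : L' y ∈ (fun z : E4 => c + z) ⁻¹' O := hy
  have hyS : y ∈ L' ⁻¹' ((fun z : E4 => c + z) ⁻¹' O) := hy
  have hcomp : (fun y : E4 => f (c + L' y)) = (fun z : E4 => f (c + z)) ∘ L' := rfl
  rw [hcomp, ← iteratedFDerivWithin_of_isOpen j hS hyS,
    L'.iteratedFDerivWithin_comp_right hf' hO'.uniqueDiffOn hS.uniqueDiffOn hyO'
      (by exact_mod_cast le_top),
    iteratedFDerivWithin_of_isOpen j hO' hyO', iteratedFDeriv_comp_add_left]
  calc ‖(iteratedFDeriv ℝ j f (c + L' y)).compContinuousLinearMap fun _ => L'‖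
      ≤ ‖iteratedFDeriv ℝ j f (c + L' y)‖ * ∏ _i : Fin j, ‖L'‖ :=
        ContinuousMultilinearMap.norm_compContinuousLinearMap_le _ _
    _ = ‖L'‖ ^ j * ‖iteratedFDeriv ℝ j f (c + L' y)‖ := by
        rw [Finset.prod_const, Finset.card_univ, Fintype.card_fin, mul_comm]

/-- **`Cʲ` size of a bilinear-form-valued map after an affine reparametrisation and composition
with `L` in both slots.** If `G : E4 → (E4 →L[ℝ] E4 →L[ℝ] ℝ)` is `C^∞` on the open set `O` and
`c + L' y ∈ O`, then
`‖Dʲ(y ↦ G (c + L' y) (L ·, L ·))(y)‖ ≤ ‖L‖² · ‖L'‖ʲ · ‖Dʲ G (c + L' y)‖`: the map is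
`B ∘ (y ↦ G (c + L' y))` with `B : G ↦ G (L ·, L ·)` continuous linear of norm `≤ ‖L‖²`
(`compAffine_exists_bilinearCompCLM`), whose `j`-th derivative is `B ∘ Dʲ(y ↦ G (c + L' y))(y)`
(Mathlib `ContinuousLinearMap.iteratedFDeriv_comp_left`,
`ContinuousLinearMap.norm_compContinuousMultilinearMap_le`), and
`affineBounds_norm_iteratedFDeriv_comp_affine_le` bounds the inner factor. [folklore] -/
theorem affineBounds_norm_iteratedFDeriv_bilinearComp_affine_le
    (G : E4 → E4 →L[ℝ] E4 →L[ℝ] ℝ) (L L' : E4 →L[ℝ] E4) (c : E4) {O : Set E4} (hO : IsOpen O)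
    (hG : ContDiffOn ℝ ∞ G O) (j : ℕ) {y : E4} (hy : c + L' y ∈ O) :
    ‖iteratedFDeriv ℝ j (fun y : E4 => (G (c + L' y)).bilinearComp L L) y‖ ≤
      ‖L‖ ^ 2 * ‖L'‖ ^ j * ‖iteratedFDeriv ℝ j G (c + L' y)‖ := by
  obtain ⟨B, hBnorm, hBapply⟩ := compAffine_exists_bilinearCompCLM L
  have hcomp : (fun y : E4 => (G (c + L' y)).bilinearComp L L) = B ∘ fun y : E4 => G (c + L' y) :=
    funext fun y => (hBapply _).symm
  -- `y ↦ G (c + L' y)` is `C^∞` at `y`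
  have hGy : ContDiffAt ℝ ∞ (fun y : E4 => G (c + L' y)) y :=
    (hG.contDiffAt (hO.mem_nhds hy)).comp y (contDiff_const.add L'.contDiff).contDiffAt
  rw [hcomp, B.iteratedFDeriv_comp_left hGy (by exact_mod_cast le_top)]
  calc ‖B.compContinuousMultilinearMap (iteratedFDeriv ℝ j (fun y : E4 => G (c + L' y)) y)‖
      ≤ ‖B‖ * ‖iteratedFDeriv ℝ j (fun y : E4 => G (c + L' y)) y‖ :=
        ContinuousLinearMap.norm_compContinuousMultilinearMap_le _ _
    _ ≤ (‖L‖ * ‖L‖) * (‖L'‖ ^ j * ‖iteratedFDeriv ℝ j G (c + L' y)‖) :=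
        mul_le_mul hBnorm (affineBounds_norm_iteratedFDeriv_comp_affine_le G L' c hO hG j hy)
          (norm_nonneg _) (by positivity)
    _ = ‖L‖ ^ 2 * ‖L'‖ ^ j * ‖iteratedFDeriv ℝ j G (c + L' y)‖ := by ring

/-- (N-3c) **Operator-norm bounds for iterated derivatives under affine reparametrisation.**
For `G` (bilinear-form valued) resp. `f` (real valued) `C^∞` on an open `O ∋ c + L' y`:
`‖Dʲ(y ↦ G (c + L' y) (L ·, L ·))(y)‖ ≤ ‖L‖² ‖L'‖ʲ ‖Dʲ G (c + L' y)‖` and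
`‖Dʲ(y ↦ f (c + L' y))(y)‖ ≤ ‖L'‖ʲ ‖Dʲ f (c + L' y)‖` — iterated derivatives of `y ↦ f (c + L' y)`
are those of `f` composed with `L'` in each slot (factor `‖L'‖ʲ`), post-composition with the
continuous linear `G ↦ G (L ·, L ·)` costs `‖L‖²`, translation by `c` costs nothing (Mathlib's
`ContinuousLinearMap.iteratedFDeriv(Within)_comp_left/right`, `iteratedFDeriv_comp_add_left`).
[folklore] -/
theorem stub_affineIteratedFDerivBounds :
    (∀ (G : E4 → E4 →L[ℝ] E4 →L[ℝ] ℝ) (L L' : E4 →L[ℝ] E4) (c : E4) (O : Set E4),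
      IsOpen O → ContDiffOn ℝ ∞ G O → ∀ (j : ℕ) (y : E4), c + L' y ∈ O →
      ‖iteratedFDeriv ℝ j (fun y : E4 => (G (c + L' y)).bilinearComp L L) y‖ ≤
        ‖L‖ ^ 2 * ‖L'‖ ^ j * ‖iteratedFDeriv ℝ j G (c + L' y)‖) ∧
    (∀ (f : E4 → ℝ) (L' : E4 →L[ℝ] E4) (c : E4) (O : Set E4),
      IsOpen O → ContDiffOn ℝ ∞ f O → ∀ (j : ℕ) (y : E4), c + L' y ∈ O →
      ‖iteratedFDeriv ℝ j (fun y : E4 => f (c + L' y)) y‖ ≤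
        ‖L'‖ ^ j * ‖iteratedFDeriv ℝ j f (c + L' y)‖) :=
  ⟨fun G L L' c _O hO hG j _y hy ↦
      affineBounds_norm_iteratedFDeriv_bilinearComp_affine_le G L L' c hO hG j hy,
    fun f L' c _O hO hf j _y hy ↦ affineBounds_norm_iteratedFDeriv_comp_affine_le f L' c hO hf j hy⟩

end Summit.FinalStateConjecture.FinalStateConjecture.Theorems

end
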